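import Literature.AlgebraicGeometry.Resolution.WeightedCentreInvariantSet
import Literature.AlgebraicGeometry.Resolution.WeightedBlowupNoIncrease
import HarnessLib

/-!
# The weighted blow-up STEP in the kernel `W(f)` model: transport, the step germ,
"`a₁` never increases", and the torus classes of the exceptional fibre

[ATW24] Abramovich–Temkin–Włodarczyk, *Functorial embedded resolution via weighted blowings up*,
Algebra & Number Theory 18:8 (2024) 1557–1587: Lemma 5.2.10 (p. 1577: rigidity of the centre under
a change of the parameters), Thm. 5.3.1 (2)–(3) (p. 1578: `inv_I(p)` is the MAXIMAL invariant of a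
centre admissible for `I`; "`b₁ ≤ a₁`"), §5.1 (p. 1575: the order on invariants, truncations larger).
[AQS25] Abramovich–Quek–Schober, *Torus actions, weighted blow-ups, and desingularization of plane
curves* (arXiv:2507.01232), Construction 4.2 (the degeneration `B → 𝔸¹` and the `𝔾_m`-action
`t·(s, x') = (t⁻¹s, t^{w}x')`), Def. 4.3 (`Bl_J̄(S) = [B₊/𝔾_m]`), Def. 4.5 (the proper transform
`F' = s^{-ℓ} F(s^{w} u')` on `B`, typed in `WeightedBlowupShade.cobordantTransform` /
`pointPolynomial`).
[AQS24] Abramovich–Quek–Schober, *Resolving plane curves using stack-theoretic blow-ups*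
(arXiv:2412.16426), Thm. 1.1 (3) (p. 3) and §6 (Def. 6.1, "The order drops", p. 12): for a plane
curve and ITS maximal centre the order of the proper transform at every point over `q` is STRICTLY
smaller than `a₁`, in every characteristic (proof: restrict to `{s = 0}`).  §3 below is the weak
inequality `≤ a₁` in every dimension and for every first-block centre, by the same restriction; it is
sharp in dimension `≥ 3` (Whitney umbrella in characteristic `2`: the order is kept,
`KangarooAtlasCertWeighted.whitney_loop`).

## The model and what is proved

This file is a companion of `WeightedCentreInvariantSet` (the set `W(f)` of invariants of the centres
`(Ψ, γ)` admissible for `f ∈ k[X₁, …, Xₙ]`, polynomial model at the origin) and of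
`WeightedBlowupNoIncrease` (the initial monomials survive the weighted step).  It types the STEP of
the observatory's step census: blow up a centre `(Ψ, γ)` for `f` with integer weights `wᵢ = ℓγᵢ`,
pass to the cobordant chart `x = Ψ`-coordinates, `zᵢ = s^{wᵢ} z'ᵢ`, and look at the transform
`G = s^{-ℓ} g(s^{w} z')` (`g = Ψ⁻¹ f`) at a point `b` of the exceptional divisor `{s = 0}` lying over
the origin (`b none = 0`, and `bᵢ = 0` at the variables off the centre, `γᵢ = 0`):
`stepGerm w ℓ b g ∈ k[X₀, …, Xₙ]` (`X₀ = s`, `X_{i+1} = z'ᵢ`).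

* §1 TRANSPORT. `admissibleInvariants_map_eq` — **`W(Φ f) = W(f)` for every origin-fixing
  coordinate change `Φ`** (centres are transported by `Ψ ↦ Ψ ∘ Φ`; the inverse of an origin-fixing
  automorphism fixes the origin, by the rigidity `ν_𝟙(Φ⁻¹ Xᵢ) = 1` of
  `WeightedBlowupMonomialValuation`); `admissibleInvariants_C_mul` (`W(c·f) = W(f)`, `c ≠ 0`),
  `admissibleInvariants_mul_eq_of_constantCoeff_ne_zero` (**`W(u·f) = W(f)` for a polynomial `u` with
  `u(0) ≠ 0`**) and `admissibleInvariants_subset_mul` (`W(f) ⊆ W(g·f)`).  So `W` is an invariant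
  of the polynomial contact class of `f` at the origin. [ATW24, Lemma 5.2.10 and Thm. 5.3.1 (3)]
* §2 THE STEP GERM. `stepGerm`, and `monomialOrd_one_rename_equiv` (the order does not depend on the
  names of the variables).
* §3 **"`a₁` NEVER INCREASES."** `monomialOrd_one_pointPolynomial_le` — for `F` of order `ν`,
  admissible for `γ` with `γᵢ·ν ≤ 1` for all `i` (the centre lies in the FIRST BLOCK of `W`: its
  invariant starts with `ν`; by `forall_mul_le_one_of_maximal` this holds for every
  `TruncLex`-maximal centre), `wᵢ = ℓγᵢ`, `ℓ > 0`, and every point `b` of `{s = 0}` over the origin,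
  **the order of the transform at `b` is `≤ ν`**: an initial monomial `X^α` of `F` (`|α| = ν`)
  survives with its coefficient (`WeightedBlowupNoIncrease.coeff_pointPolynomial_mapDomain_some`).
  In the `W`-language (`monomialOrd_one_stepGerm_le`, `exists_mem_le_of_mem_admissibleInvariants_stepGerm`,
  `not_singleton_lt_of_mem_admissibleInvariants_stepGerm`): every invariant `b' ∈ W(G)` of the new
  germ has an entry `≤ ν`, so its first entry is `≤ ν = a₁(f)` — the truncated invariant `(a₁)` does
  not increase under the weighted blow-up of a first-block centre, at any point over the origin.
  (The published theorem [ATW24, Thm. 6.2.1 (p. 1581)] is the decrease of the WHOLE invariant at every point, in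
  characteristic `0`, for the centre of maximal invariant; here: position `1` only, every
  characteristic, every first-block centre, polynomial model — derived here, elementary.)
* §5 THE TORUS CLASSES (after §4 in the file). `pointPolynomial_torusPoint` — for `t ≠ 0` and a
  point `(0, b)` of `{s = 0}`, **`G_{t·b} = t^{ℓ}·D_t(G_b)`** with `t·b = (0, t^{wᵢ}bᵢ)` and `D_t` the
  diagonal scaling `s ↦ ts`, `z'ᵢ ↦ t^{-wᵢ}z'ᵢ` (`diagScale`; semi-invariance
  `diagScale_cobordantTransform`: `D_t F' = t^{-ℓ}F'`, and `translate_diagScale`: scalings conjugate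
  translations); hence `admissibleInvariants_stepGerm_torusPoint`: **`W(G_{t·b}) = W(G_b)`** — one
  representative per `k^×`-class of the exceptional fibre suffices. [AQS25, Construction 4.2, Def. 4.3]
* §4 THE VERDICTS of a step, typed on sets of invariants: `IsMaxInv W a` (`a` is the
  `TruncLex`-maximum of `W`), `StepDrops a W'` (every new invariant is below the old maximum —
  vacuous at a point off the transform), `StepStalls a W'` (the old maximum is the new maximum: the
  loop / "kangaroo" signal of the observatory), `StepIncreases a W'`; their reading against a
  certified new maximum (`stepDrops_iff`, `stepStalls_iff`, `stepIncreases_iff`), exclusivity and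
  trichotomy; and the POSITION-1 RULES: `exists_eq_cons_of_isMaxInv` (the maximum of `W(g)` starts
  with `ord g`), `stepDrops_of_monomialOrd_lt` / `stepDrops_of_isMaxInv_of_monomialOrd_lt` (order
  drops ⟹ DROP against the certified old maximum), so that after §3 the verdict of a first-block step
  at a point over the origin is decided at positions `≥ 2` exactly when the order is kept.

Everything is elementary and proved here; no published theorem is asserted as a fact.  Centres given
by formal / étale coordinate changes, and points of the blow-up NOT over the origin, are outside the
model.
-/

noncomputable section

open MvPolynomial

namespace Literature.AlgebraicGeometry.Resolution

namespace WeightedBlowup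

/-! ## §1 Transport: `W(Φ f) = W(f)`, `W(u·f) = W(f)` -/

section Transport

variable {k : Type*} [Field k] {n : ℕ}

/-- An origin-fixing coordinate change does not change the order at the origin:
`ν_𝟙(Φ g) = ν_𝟙(g)`. [cite: AbramovichTemkinWlodarczyk2024, Lemma 5.2.10 (p. 1577)] -/
theorem monomialOrd_one_map_eq (Φ : MvPolynomial (Fin n) k ≃ₐ[k] MvPolynomial (Fin n) k)
    (hΦ : ∀ i, constantCoeff (Φ (X i)) = 0) (g : MvPolynomial (Fin n) k) :
    monomialOrd (fun _ => 1) (Φ g) = monomialOrd (fun _ => 1) g :=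
  monomialOrd_ringEquiv_eq (fun _ => 1) (Φ : MvPolynomial (Fin n) k ≃+* MvPolynomial (Fin n) k)
    (fun i => by
      rw [Nat.cast_one]
      exact one_le_monomialOrd_one_of_constantCoeff_eq_zero _ (hΦ i)) g

/-- Origin-fixing changes map the maximal ideal of the origin into itself:
`g(0) = 0 ⟹ (Φ g)(0) = 0`. [cite: AbramovichTemkinWlodarczyk2024, Lemma 5.2.10 (p. 1577)
(changes of regular parameters at `p` preserve `m_p`)] -/
theorem constantCoeff_map_eq_zero (Φ : MvPolynomial (Fin n) k ≃ₐ[k] MvPolynomial (Fin n) k)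
    (hΦ : ∀ i, constantCoeff (Φ (X i)) = 0) {g : MvPolynomial (Fin n) k}
    (hg : constantCoeff g = 0) : constantCoeff (Φ g) = 0 := by
  by_contra h
  have h0 := monomialOrd_eq_zero_of_constantCoeff_ne_zero (fun _ => (1 : ℕ)) h
  have h1 := one_le_monomialOrd_one_of_constantCoeff_eq_zero g hg
  rw [← monomialOrd_one_map_eq Φ hΦ g, h0] at h1
  simp at h1

/-- Conversely `(Φ g)(0) = 0 ⟹ g(0) = 0`; so units stay units: `u(0) ≠ 0 ⟹ (Φ u)(0) ≠ 0`.
[cite: AbramovichTemkinWlodarczyk2024, Lemma 5.2.10 (p. 1577) (changes of regular parameters at `p`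
preserve `m_p`)] -/
theorem constantCoeff_ne_zero_map (Φ : MvPolynomial (Fin n) k ≃ₐ[k] MvPolynomial (Fin n) k)
    (hΦ : ∀ i, constantCoeff (Φ (X i)) = 0) {u : MvPolynomial (Fin n) k}
    (hu : constantCoeff u ≠ 0) : constantCoeff (Φ u) ≠ 0 := by
  intro h
  have h0 := monomialOrd_eq_zero_of_constantCoeff_ne_zero (fun _ => (1 : ℕ)) hu
  have h1 := one_le_monomialOrd_one_of_constantCoeff_eq_zero (Φ u) h
  rw [monomialOrd_one_map_eq Φ hΦ u, h0] at h1
  simp at h1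

/-- **The inverse of an origin-fixing automorphism fixes the origin** (`ν_𝟙(Φ⁻¹ Xᵢ) = 1` by
rigidity). [cite: AbramovichTemkinWlodarczyk2024, Lemma 5.2.10 (p. 1577)] -/
theorem constantCoeff_symm_X_eq_zero_of_forall
    (Φ : MvPolynomial (Fin n) k ≃ₐ[k] MvPolynomial (Fin n) k)
    (hΦ : ∀ i, constantCoeff (Φ (X i)) = 0) (i : Fin n) : constantCoeff (Φ.symm (X i)) = 0 := by
  by_contra h
  have h0 := monomialOrd_eq_zero_of_constantCoeff_ne_zero (fun _ => (1 : ℕ)) h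
  have h1 := monomialOrd_ringEquiv_symm_X (fun _ => (1 : ℕ))
    (Φ : MvPolynomial (Fin n) k ≃+* MvPolynomial (Fin n) k)
    (fun i => by
      rw [Nat.cast_one]
      exact one_le_monomialOrd_one_of_constantCoeff_eq_zero _ (hΦ i)) i
  have h2 : (Φ : MvPolynomial (Fin n) k ≃+* MvPolynomial (Fin n) k).symm (X i) = Φ.symm (X i) :=
    rfl
  rw [h2, h0] at h1
  simp at h1

/-- **Centres are transported by coordinate changes**: if `(Ψ, γ)` is a centre for `f` and `Φ`
fixes the origin, then `(Ψ ∘ Φ, γ)` — the same centre read in the coordinates moved by `Φ` — is a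
centre for `Φ f`, with the same invariant. [cite: AbramovichTemkinWlodarczyk2024, Thm. 5.3.1 (3)
(p. 1578) (the centre of maximal invariant is independent of the choices; functoriality)] -/
theorem IsCentreFor.map {f : MvPolynomial (Fin n) k}
    {Ψ : MvPolynomial (Fin n) k ≃ₐ[k] MvPolynomial (Fin n) k} {γ : Fin n → ℚ}
    (h : IsCentreFor f Ψ γ) (Φ : MvPolynomial (Fin n) k ≃ₐ[k] MvPolynomial (Fin n) k)
    (hΦ : ∀ i, constantCoeff (Φ (X i)) = 0) : IsCentreFor (Φ f) (Ψ.trans Φ) γ := by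
  obtain ⟨hΨ, hγ, hadm⟩ := h
  refine ⟨fun i => ?_, hγ, ?_⟩
  · rw [AlgEquiv.trans_apply]
    exact constantCoeff_map_eq_zero Φ hΦ (hΨ i)
  · rw [AlgEquiv.symm_trans_apply, AlgEquiv.symm_apply_apply]
    exact hadm

/-- `W(f) ⊆ W(Φ f)` for an origin-fixing `Φ`. [cite: AbramovichTemkinWlodarczyk2024, Thm. 5.3.1
(2)–(3) (p. 1578)] -/
theorem admissibleInvariants_subset_map (Φ : MvPolynomial (Fin n) k ≃ₐ[k] MvPolynomial (Fin n) k)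
    (hΦ : ∀ i, constantCoeff (Φ (X i)) = 0) (f : MvPolynomial (Fin n) k) :
    admissibleInvariants f ⊆ admissibleInvariants (Φ f) := by
  rintro b ⟨Ψ, γ, h, rfl⟩
  exact ⟨Ψ.trans Φ, γ, h.map Φ hΦ, rfl⟩

/-- **Transport: `W(Φ f) = W(f)`** for every origin-fixing coordinate change `Φ` — the set of
invariants of admissible centres (hence its maximum, the invariant) does not depend on the
coordinates. [cite: AbramovichTemkinWlodarczyk2024, Thm. 5.3.1 (2)–(3) (p. 1578)] -/
theorem admissibleInvariants_map_eq (Φ : MvPolynomial (Fin n) k ≃ₐ[k] MvPolynomial (Fin n) k)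
    (hΦ : ∀ i, constantCoeff (Φ (X i)) = 0) (f : MvPolynomial (Fin n) k) :
    admissibleInvariants (Φ f) = admissibleInvariants f := by
  refine Set.Subset.antisymm ?_ (admissibleInvariants_subset_map Φ hΦ f)
  have h := admissibleInvariants_subset_map Φ.symm (constantCoeff_symm_X_eq_zero_of_forall Φ hΦ)
    (Φ f)
  rwa [AlgEquiv.symm_apply_apply] at h

/-- `W(f) ⊆ W(g·f)`: a centre admissible for `f` is admissible for every multiple of `f`.
[cite: AbramovichTemkinWlodarczyk2024, Def. 2.4.1 (p. 1568) (admissibility `J ≤ v(I)` is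
monotone in the ideal)] -/
theorem IsCentreFor.mul_left {f : MvPolynomial (Fin n) k}
    {Ψ : MvPolynomial (Fin n) k ≃ₐ[k] MvPolynomial (Fin n) k} {γ : Fin n → ℚ}
    (h : IsCentreFor f Ψ γ) (g : MvPolynomial (Fin n) k) : IsCentreFor (g * f) Ψ γ := by
  obtain ⟨hΨ, hγ, hadm⟩ := h
  refine ⟨hΨ, hγ, ?_⟩
  rw [map_mul]
  exact IsAdmissibleFor.mul_left hγ _ hadm

/-- `W(f) ⊆ W(g·f)`. [cite: AbramovichTemkinWlodarczyk2024, Def. 2.4.1 (p. 1568)] -/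
theorem admissibleInvariants_subset_mul (g f : MvPolynomial (Fin n) k) :
    admissibleInvariants f ⊆ admissibleInvariants (g * f) := by
  rintro b ⟨Ψ, γ, h, rfl⟩
  exact ⟨Ψ, γ, h.mul_left g, rfl⟩

/-- `W(c·f) = W(f)` for a non-zero constant `c` (admissibility depends on the ideal `(f) = (c·f)`
only). [cite: AbramovichTemkinWlodarczyk2024, Def. 2.4.1 (p. 1568) (`J` is `I`-admissible iff
`J ≤ v(I)`, a condition on the ideal)] -/
theorem admissibleInvariants_C_mul {c : k} (hc : c ≠ 0) (f : MvPolynomial (Fin n) k) :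
    admissibleInvariants (C c * f) = admissibleInvariants f := by
  refine Set.Subset.antisymm ?_ (admissibleInvariants_subset_mul (C c) f)
  have h := admissibleInvariants_subset_mul (C c⁻¹) (C c * f)
  rwa [← mul_assoc, ← C_mul, inv_mul_cancel₀ hc, C_1, one_mul] at h

/-- Integer weights for a non-negative rational cocharacter: `N > 0` and `wᵢ ∈ ℕ` with
`wᵢ = N·γᵢ` (clear denominators). [cite: AbramovichTemkinWlodarczyk2024, Def. 2.4.1 (3) (p. 1568)
(reduced centre: integer weights)] -/
theorem exists_nat_weights {σ : Type*} [Fintype σ] (γ : σ → ℚ) (hγ : ∀ i, 0 ≤ γ i) :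
    ∃ (N : ℕ) (w : σ → ℕ), 0 < N ∧ ∀ i, (w i : ℚ) = N * γ i := by
  classical
  set D : ℕ := ∏ j, (γ j).den with hD
  have hDpos : 0 < D := Finset.prod_pos fun j _ => (γ j).den_pos
  set E : σ → ℕ := fun i => ∏ j ∈ Finset.univ.erase i, (γ j).den with hE
  set w : σ → ℕ := fun i => E i * (γ i).num.toNat with hw
  have hDq : ∀ i, (D : ℚ) = ((γ i).den : ℚ) * (E i : ℚ) := fun i => by
    have h := Finset.mul_prod_erase Finset.univ (fun j => (γ j).den) (Finset.mem_univ i)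
    rw [hD, hE]
    exact_mod_cast h.symm
  refine ⟨D, w, hDpos, fun i => ?_⟩
  have hnum : (((γ i).num.toNat : ℕ) : ℚ) = ((γ i).num : ℚ) := by
    have h := Int.toNat_of_nonneg (Rat.num_nonneg.mpr (hγ i))
    exact_mod_cast h
  rw [hw]
  push_cast
  rw [hnum, ← Rat.mul_den_eq_num (γ i), hDq i]
  ring

/-- Multiplying by a polynomial unit of the origin does not change admissibility:
`v_γ(u·G) ≥ 1 ⟺ v_γ(G) ≥ 1` for `u(0) ≠ 0`, `γ ≥ 0` (`ν_w(u) = 0`).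
[cite: AbramovichTemkinWlodarczyk2024, Rem. 2.4.2 and Rem. 5.2.3 (valuative reading of
admissibility)] -/
theorem isAdmissibleFor_mul_iff_of_constantCoeff_ne_zero {σ : Type*} [Fintype σ] {γ : σ → ℚ}
    (hγ : ∀ i, 0 ≤ γ i) {u : MvPolynomial σ k} (hu : constantCoeff u ≠ 0) (G : MvPolynomial σ k) :
    IsAdmissibleFor γ (u * G) ↔ IsAdmissibleFor γ G := by
  obtain ⟨N, w, hN, hw⟩ := exists_nat_weights γ hγ
  rw [isAdmissibleFor_iff_le_monomialOrd γ w hN hw, isAdmissibleFor_iff_le_monomialOrd γ w hN hw,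
    monomialOrd_mul_of_constantCoeff_ne_zero w hu]

/-- **`W(u·f) = W(f)` for a polynomial unit `u` of the origin** (`u(0) ≠ 0`): `W` is an invariant
of the contact class. [cite: AbramovichTemkinWlodarczyk2024, Thm. 5.3.1 (2)–(3) (p. 1578)] -/
theorem admissibleInvariants_mul_eq_of_constantCoeff_ne_zero {u : MvPolynomial (Fin n) k}
    (hu : constantCoeff u ≠ 0) (f : MvPolynomial (Fin n) k) :
    admissibleInvariants (u * f) = admissibleInvariants f := by
  have key : ∀ (Ψ : MvPolynomial (Fin n) k ≃ₐ[k] MvPolynomial (Fin n) k) (γ : Fin n → ℚ),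
      IsCentreFor (u * f) Ψ γ ↔ IsCentreFor f Ψ γ := by
    intro Ψ γ
    constructor
    · rintro ⟨hΨ, hγ, hadm⟩
      refine ⟨hΨ, hγ, ?_⟩
      rw [map_mul] at hadm
      have hu' : constantCoeff (Ψ.symm u) ≠ 0 :=
        constantCoeff_ne_zero_map Ψ.symm (constantCoeff_symm_X_eq_zero_of_forall Ψ hΨ) hu
      exact (isAdmissibleFor_mul_iff_of_constantCoeff_ne_zero hγ hu' _).mp hadm
    · intro h
      exact h.mul_left u
  ext b
  constructor
  · rintro ⟨Ψ, γ, h, rfl⟩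
    exact ⟨Ψ, γ, (key Ψ γ).mp h, rfl⟩
  · rintro ⟨Ψ, γ, h, rfl⟩
    exact ⟨Ψ, γ, (key Ψ γ).mpr h, rfl⟩

end Transport

/-! ## §2 The step germ -/

section Rename

variable {σ τ : Type*} {K : Type*} [CommRing K]

/-- The all-one weight of an exponent does not change under renaming the variables. [folklore] -/
private theorem weight_one_mapDomain (e : σ → τ) (d : σ →₀ ℕ) :
    Finsupp.weight (fun _ => (1 : ℕ)) (d.mapDomain e) = Finsupp.weight (fun _ => (1 : ℕ)) d := by
  have h := Finsupp.degree_mapDomain e d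
  simpa only [Finsupp.degree_eq_weight_one] using h

/-- Renaming the variables along an injection does not raise the order: `ν_𝟙(G(X_{e(i)})) ≤ ν_𝟙(G)`
(in fact equality). [folklore] -/
private theorem monomialOrd_one_rename_le (e : σ → τ) (he : Function.Injective e) (G : MvPolynomial σ K) :
    monomialOrd (fun _ => 1) (rename e G) ≤ monomialOrd (fun _ => 1) G := by
  classical
  by_cases hG : G = 0
  · simp [hG, monomialOrd_zero]
  · obtain ⟨d, hd, hdw⟩ := exists_weight_eq_monomialOrd (fun _ => (1 : ℕ)) hG
    rw [← hdw]
    have hmem : d.mapDomain e ∈ (rename e G).support := by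
      rw [mem_support_iff, coeff_rename_mapDomain e he]
      exact mem_support_iff.mp hd
    calc monomialOrd (fun _ => 1) (rename e G)
        ≤ Finsupp.weight (fun _ => (1 : ℕ)) (d.mapDomain e) := monomialOrd_le_weight _ hmem
      _ = Finsupp.weight (fun _ => (1 : ℕ)) d := by rw [weight_one_mapDomain]

/-- **The order does not depend on the names of the variables**: `ν_𝟙(G(X_{e(i)})) = ν_𝟙(G)` for a
bijection `e`. [cite: AbramovichTemkinWlodarczyk2024, §5.1 (p. 1575) (`a₁ = ord_p(I)` is intrinsic)] -/
theorem monomialOrd_one_rename_equiv (e : σ ≃ τ) (G : MvPolynomial σ K) :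
    monomialOrd (fun _ => 1) (rename e G) = monomialOrd (fun _ => 1) G := by
  refine le_antisymm (monomialOrd_one_rename_le e e.injective G) ?_
  have h := monomialOrd_one_rename_le e.symm e.symm.injective (rename e G)
  rw [rename_rename, Equiv.symm_comp_self, rename_id, AlgHom.id_apply] at h
  exact h

end Rename

section StepGerm

variable {k : Type*} [Field k] {n : ℕ}

/-- **The step germ.** For a centre with integer weights `w` (`wᵢ = ℓγᵢ`) blown up on the cobordant
chart `zᵢ = s^{wᵢ} z'ᵢ`, the transform `G = s^{-ℓ} g(s^{w} z')` of `g` at the point `z' = b` of the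
exceptional divisor `{s = 0}` (`WeightedBlowupShade.pointPolynomial`), written as a polynomial in
`k[X₀, …, Xₙ]` with `X₀ = s` and `X_{i+1} = z'ᵢ − bᵢ` (so that `W(G)` of `WeightedCentreInvariantSet`
applies to it). [cite: AbramovichQuekSchober2025, Def. 4.5 (proper transform on `B`)] -/
def stepGerm (w : Fin n → ℕ) (ℓ : ℕ) (b : Option (Fin n) → k) (g : MvPolynomial (Fin n) k) :
    MvPolynomial (Fin (n + 1)) k :=
  rename (finSuccEquiv n).symm (pointPolynomial w ℓ b g)

/-- The step germ has the order of the transform at `b`.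
[cite: AbramovichTemkinWlodarczyk2024, §5.1 (p. 1575) (`a₁ = ord_p` is intrinsic)] -/
theorem monomialOrd_one_stepGerm (w : Fin n → ℕ) (ℓ : ℕ) (b : Option (Fin n) → k)
    (g : MvPolynomial (Fin n) k) :
    monomialOrd (fun _ => 1) (stepGerm w ℓ b g) =
      monomialOrd (fun _ => 1) (pointPolynomial w ℓ b g) :=
  monomialOrd_one_rename_equiv _ _

end StepGerm

/-! ## §3 "`a₁` never increases": the order at every point over the origin is `≤ ν` -/

section NoIncrease

variable {σ : Type*} {K : Type*} [CommRing K] [Fintype σ] [DecidableEq σ]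

/-- **The order does not increase under the weighted blow-up of a first-block centre.**  Let `F` have
order `ν` and be admissible for the cocharacter `γ` with `γᵢ·ν ≤ 1` for all `i` (every exponent of
the centre is `≥ ν = ord F`: the centre's invariant starts with `ν`), `wᵢ = ℓγᵢ ∈ ℕ`, `ℓ > 0`, and
let `b` be a point of the exceptional divisor over the origin (`b none = 0`; `bᵢ = 0` off the
centre).  Then the transform `s^{-ℓ}F(s^{w}u')` has order `≤ ν` at `b`: an initial monomial `u^α`
of `F` (`|α| = ν`) lies on the face `v_γ = 1` and survives at `b` with its coefficient
(`coeff_pointPolynomial_mapDomain_some`). (derived here)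
[cite: AbramovichTemkinWlodarczyk2024, Thm. 5.3.1 (2) (p. 1578) ("b₁ ≤ a₁") and Thm. 6.2.1 (p. 1581) (the
invariant drops — there: char. 0, the maximal centre, the whole invariant)] -/
theorem monomialOrd_one_pointPolynomial_le (γ : σ → ℚ) (w : σ → ℕ) (ℓ : ℕ) (b : Option σ → K)
    (F : MvPolynomial σ K) (ν : ℕ) (hν : monomialOrd (fun _ => 1) F = ν)
    (hadm : IsAdmissibleFor γ F) (hγν : ∀ i, γ i * ν ≤ 1)
    (hw : ∀ i, (w i : ℚ) = ℓ * γ i) (hℓ : 0 < ℓ)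
    (hb0 : b none = 0) (hbS : ∀ i, γ i = 0 → b (some i) = 0) :
    monomialOrd (fun _ => 1) (pointPolynomial w ℓ b F) ≤ ν := by
  classical
  have hF0 : F ≠ 0 := by
    rintro rfl
    rw [monomialOrd_zero] at hν
    exact ENat.top_ne_coe ν hν
  obtain ⟨α, hα, hαw⟩ := exists_weight_eq_monomialOrd (fun _ => (1 : ℕ)) hF0
  have hαν : (Finsupp.weight (fun _ => (1 : ℕ)) α : ℕ∞) = ν := hαw.trans hν
  have hdeg : α.degree = ν := by
    rw [Finsupp.degree_eq_weight_one]
    exact_mod_cast hαν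
  have hcoef := coeff_pointPolynomial_mapDomain_some γ w ℓ b F α ν hadm hγν hw hℓ hb0 hbS
    (mem_support_iff.mp hα) hdeg
  have hmem : α.mapDomain some ∈ (pointPolynomial w ℓ b F).support := by
    rw [mem_support_iff, hcoef]
    exact mem_support_iff.mp hα
  calc monomialOrd (fun _ => 1) (pointPolynomial w ℓ b F)
      ≤ Finsupp.weight (fun _ => (1 : ℕ)) (α.mapDomain some) := monomialOrd_le_weight _ hmem
    _ = Finsupp.weight (fun _ => (1 : ℕ)) α := by rw [weight_one_mapDomain]
    _ = ν := hαν

end NoIncrease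

section Kernel

variable {k : Type*} [Field k] {n : ℕ}

/-- **A `TruncLex`-maximal centre lies in the first block**: if the invariant of the centre
`(Ψ, γ)` for `f` (`ord f = ν`) is not exceeded in `W(f)`, then `γᵢ·ν ≤ 1` for all `i` (all its
exponents are `≥ ν`) — otherwise it is beaten by `(X₁^ν, …, Xₙ^ν)`.
[cite: AbramovichTemkinWlodarczyk2024, Thm. 5.3.1 (2) and its proof (p. 1578) ("b₁ ≤ a₁")] -/
theorem forall_mul_le_one_of_maximal {f : MvPolynomial (Fin n) k} {ν : ℕ}
    (hν : monomialOrd (fun _ => 1) f = ν)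
    {Ψ : MvPolynomial (Fin n) k ≃ₐ[k] MvPolynomial (Fin n) k} {γ : Fin n → ℚ}
    (h : IsCentreFor f Ψ γ)
    (hmax : ∀ b ∈ admissibleInvariants f, ¬ ATW.TruncLex.lt (exps γ) b) : ∀ i, γ i * ν ≤ 1 := by
  intro i
  by_contra hlt
  rw [not_le] at hlt
  have hν0 : 0 < ν := by
    rcases Nat.eq_zero_or_pos ν with h0 | h0
    · rw [h0, Nat.cast_zero, mul_zero] at hlt
      exact absurd hlt (by norm_num)
    · exact h0
  have hν0' : (0 : ℚ) < ν := by exact_mod_cast hν0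
  have hi : (ν : ℚ)⁻¹ < γ i :=
    lt_of_mul_lt_mul_right (by rwa [inv_mul_cancel₀ hν0'.ne']) hν0'.le
  exact hmax _ (replicate_mem_admissibleInvariants hν hν0).1
    (truncLex_lt_replicate_of_lt hν h hi i.pos)

/-- **`a₁` never increases (kernel `W(f)` model).**  For a centre `(Ψ, γ)` for `f` in the first
block (`γᵢ·ν ≤ 1`, `ν = ord f`; e.g. any `TruncLex`-maximal one), integer weights `wᵢ = ℓγᵢ`,
`ℓ > 0`, and a point `b` of the exceptional divisor over the origin, the step germ has order `≤ ν`.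
(derived here) [cite: AbramovichTemkinWlodarczyk2024, Thm. 5.3.1 (2) (p. 1578) and Thm. 6.2.1 (p. 1581)] -/
theorem monomialOrd_one_stepGerm_le {f : MvPolynomial (Fin n) k} {ν : ℕ}
    (hν : monomialOrd (fun _ => 1) f = ν)
    {Ψ : MvPolynomial (Fin n) k ≃ₐ[k] MvPolynomial (Fin n) k} {γ : Fin n → ℚ}
    (h : IsCentreFor f Ψ γ) (hγν : ∀ i, γ i * ν ≤ 1)
    {w : Fin n → ℕ} {ℓ : ℕ} (hw : ∀ i, (w i : ℚ) = ℓ * γ i) (hℓ : 0 < ℓ)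
    {b : Option (Fin n) → k} (hb0 : b none = 0) (hbS : ∀ i, γ i = 0 → b (some i) = 0) :
    monomialOrd (fun _ => 1) (stepGerm w ℓ b (Ψ.symm f)) ≤ ν := by
  rw [monomialOrd_one_stepGerm]
  have hg : monomialOrd (fun _ => 1) (Ψ.symm f) = ν := by
    rw [monomialOrd_one_symm_eq Ψ h.1 f, hν]
  exact monomialOrd_one_pointPolynomial_le γ w ℓ b (Ψ.symm f) ν hg h.2.2 hγν hw hℓ hb0 hbS

/-- If `ord g ≤ ν` then every invariant in `W(g)` has an entry `≤ ν`.
[cite: AbramovichTemkinWlodarczyk2024, Thm. 5.3.1 (2) and its proof (p. 1578) ("b₁ ≤ a₁")] -/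
theorem exists_mem_le_of_monomialOrd_le {m : ℕ} {g : MvPolynomial (Fin m) k} {ν : ℕ}
    (hle : monomialOrd (fun _ => 1) g ≤ ν) {b' : List ℚ} (hb' : b' ∈ admissibleInvariants g) :
    ∃ x ∈ b', x ≤ ν := by
  have htop : monomialOrd (fun _ => 1) g ≠ ⊤ := fun h => by
    rw [h] at hle
    exact ENat.coe_ne_top ν (top_le_iff.mp hle)
  obtain ⟨ν', hν'⟩ : ∃ ν' : ℕ, monomialOrd (fun _ => 1) g = ν' := ⟨_, (ENat.coe_toNat htop).symm⟩
  have hν'le : ν' ≤ ν := by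
    rw [hν'] at hle
    exact_mod_cast hle
  obtain ⟨x, hx, hxle⟩ := exists_mem_le_of_mem_admissibleInvariants hν' hb'
  exact ⟨x, hx, hxle.trans (by exact_mod_cast hν'le)⟩

/-- If `ord g ≤ ν` then no invariant in `W(g)` exceeds the truncated invariant `(ν)`: its first entry
is `≤ ν`. [cite: AbramovichTemkinWlodarczyk2024, Thm. 5.3.1 (2) and its proof (p. 1578), §5.1
(p. 1575)] -/
theorem not_singleton_lt_of_monomialOrd_le {m : ℕ} {g : MvPolynomial (Fin m) k} {ν : ℕ}
    (hle : monomialOrd (fun _ => 1) g ≤ ν) {b' : List ℚ} (hb' : b' ∈ admissibleInvariants g) :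
    ¬ ATW.TruncLex.lt [(ν : ℚ)] b' := by
  obtain ⟨Ψ', γ', h', rfl⟩ := hb'
  obtain ⟨x, hx, hxν⟩ := exists_mem_le_of_monomialOrd_le hle (exps_mem_admissibleInvariants h')
  obtain ⟨e, es, hees⟩ : ∃ e es, exps γ' = e :: es := by
    cases hl : exps γ' with
    | nil => rw [hl] at hx; simp at hx
    | cons e es => exact ⟨e, es, rfl⟩
  have hs := exps_sorted γ'
  rw [hees] at hs hx ⊢
  have hex : e ≤ x := by
    rcases List.mem_cons.mp hx with rfl | hx
    · exact le_rfl
    · exact (List.pairwise_cons.mp hs).1 x hx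
  rw [ATW.TruncLex.cons_lt_cons, not_or]
  exact ⟨not_lt.mpr (hex.trans hxν), fun h => ATW.TruncLex.not_nil_lt _ h.2⟩

/-- **No INCREASE at position 1.**  Under the hypotheses of `monomialOrd_one_stepGerm_le`, every
invariant of a centre admissible for the step germ has an entry `≤ ν = a₁(f)`.
(derived here) [cite: AbramovichTemkinWlodarczyk2024, Thm. 5.3.1 (2) (p. 1578) and Thm. 6.2.1 (p. 1581)] -/
theorem exists_mem_le_of_mem_admissibleInvariants_stepGerm {f : MvPolynomial (Fin n) k} {ν : ℕ}
    (hν : monomialOrd (fun _ => 1) f = ν)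
    {Ψ : MvPolynomial (Fin n) k ≃ₐ[k] MvPolynomial (Fin n) k} {γ : Fin n → ℚ}
    (h : IsCentreFor f Ψ γ) (hγν : ∀ i, γ i * ν ≤ 1)
    {w : Fin n → ℕ} {ℓ : ℕ} (hw : ∀ i, (w i : ℚ) = ℓ * γ i) (hℓ : 0 < ℓ)
    {b : Option (Fin n) → k} (hb0 : b none = 0) (hbS : ∀ i, γ i = 0 → b (some i) = 0)
    {b' : List ℚ} (hb' : b' ∈ admissibleInvariants (stepGerm w ℓ b (Ψ.symm f))) :
    ∃ x ∈ b', x ≤ ν :=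
  exists_mem_le_of_monomialOrd_le (monomialOrd_one_stepGerm_le hν h hγν hw hℓ hb0 hbS) hb'

/-- **The truncated invariant `(a₁)` does not increase**: no invariant of the step germ exceeds
`(ν)`. (derived here) [cite: AbramovichTemkinWlodarczyk2024, Thm. 5.3.1 (2) (p. 1578), §5.1
(p. 1575) and Thm. 6.2.1 (p. 1581)] -/
theorem not_singleton_lt_of_mem_admissibleInvariants_stepGerm {f : MvPolynomial (Fin n) k} {ν : ℕ}
    (hν : monomialOrd (fun _ => 1) f = ν)
    {Ψ : MvPolynomial (Fin n) k ≃ₐ[k] MvPolynomial (Fin n) k} {γ : Fin n → ℚ}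
    (h : IsCentreFor f Ψ γ) (hγν : ∀ i, γ i * ν ≤ 1)
    {w : Fin n → ℕ} {ℓ : ℕ} (hw : ∀ i, (w i : ℚ) = ℓ * γ i) (hℓ : 0 < ℓ)
    {b : Option (Fin n) → k} (hb0 : b none = 0) (hbS : ∀ i, γ i = 0 → b (some i) = 0)
    {b' : List ℚ} (hb' : b' ∈ admissibleInvariants (stepGerm w ℓ b (Ψ.symm f))) :
    ¬ ATW.TruncLex.lt [(ν : ℚ)] b' :=
  not_singleton_lt_of_monomialOrd_le (monomialOrd_one_stepGerm_le hν h hγν hw hℓ hb0 hbS) hb'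

end Kernel

/-! ## §4 The verdicts of a step: DROP / STALL / INCREASE -/

section Verdicts

/-- `a` is the `TruncLex`-maximum of the set of invariants `W` ("certified max": attained, and not
exceeded). [cite: AbramovichTemkinWlodarczyk2024, Thm. 5.3.1 (2) (p. 1578)
(`inv_I(p) = max_{…} (b₁, …, b_k)`)] -/
def IsMaxInv (W : Set (List ℚ)) (a : List ℚ) : Prop :=
  a ∈ W ∧ ∀ b ∈ W, ¬ ATW.TruncLex.lt a b

/-- The maximum is unique (`TruncLex` is trichotomous).
[cite: AbramovichTemkinWlodarczyk2024, §5.1 (p. 1575) (a total order)] -/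
theorem IsMaxInv.unique {W : Set (List ℚ)} {a a' : List ℚ} (ha : IsMaxInv W a)
    (ha' : IsMaxInv W a') : a = a' := by
  rcases ATW.TruncLex.trichotomous a a' with h | h | h
  · exact absurd h (ha.2 a' ha'.1)
  · exact h
  · exact absurd h (ha'.2 a ha.1)

/-- **Verdict DROP**: every invariant of the new germ is `TruncLex`-below the old maximum `a`
(vacuously true when the new germ admits no centre, e.g. at a point off the transform).
[cite: AbramovichTemkinWlodarczyk2024, Thm. 6.2.1 (p. 1581) ("the invariant drops")] -/
def StepDrops (a : List ℚ) (W' : Set (List ℚ)) : Prop :=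
  ∀ b ∈ W', ATW.TruncLex.lt b a

/-- **Verdict STALL**: the old maximum is again the maximum of the new germ's invariants (the loop
signal of the observatory; excluded in characteristic `0` by [ATW24, Thm. 6.2.1 (p. 1581)]).
(observatory convention, derived here) [cite: AbramovichTemkinWlodarczyk2024, Thm. 6.2.1 (p. 1581)] -/
def StepStalls (a : List ℚ) (W' : Set (List ℚ)) : Prop :=
  IsMaxInv W' a

/-- **Verdict INCREASE**: some invariant of the new germ is `TruncLex`-above the old maximum.
(observatory convention, derived here) [cite: AbramovichTemkinWlodarczyk2024, Thm. 6.2.1 (p. 1581)] -/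
def StepIncreases (a : List ℚ) (W' : Set (List ℚ)) : Prop :=
  ∃ b ∈ W', ATW.TruncLex.lt a b

variable {W' : Set (List ℚ)} {a a' : List ℚ}

/-- Reading DROP against a certified new maximum `a'`: `a' < a`.
[cite: AbramovichTemkinWlodarczyk2024, §5.1 (p. 1575)] -/
theorem stepDrops_iff (ha' : IsMaxInv W' a') : StepDrops a W' ↔ ATW.TruncLex.lt a' a := by
  constructor
  · exact fun h => h a' ha'.1
  · intro h b hb
    rcases ATW.TruncLex.trichotomous b a' with hba | rfl | hab
    · exact ATW.TruncLex.lt_trans hba h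
    · exact h
    · exact absurd hab (ha'.2 b hb)

/-- Reading STALL against a certified new maximum `a'`: `a' = a`.
[cite: AbramovichTemkinWlodarczyk2024, §5.1 (p. 1575)] -/
theorem stepStalls_iff (ha' : IsMaxInv W' a') : StepStalls a W' ↔ a' = a :=
  ⟨fun h => ha'.unique h, fun h => h ▸ ha'⟩

/-- Reading INCREASE against a certified new maximum `a'`: `a < a'`.
[cite: AbramovichTemkinWlodarczyk2024, §5.1 (p. 1575)] -/
theorem stepIncreases_iff (ha' : IsMaxInv W' a') :
    StepIncreases a W' ↔ ATW.TruncLex.lt a a' := by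
  constructor
  · rintro ⟨b, hb, hab⟩
    rcases ATW.TruncLex.trichotomous b a' with hba | rfl | hab'
    · exact ATW.TruncLex.lt_trans hab hba
    · exact hab
    · exact absurd hab' (ha'.2 b hb)
  · exact fun h => ⟨a', ha'.1, h⟩

/-- DROP and INCREASE exclude each other (no hypothesis). [cite: AbramovichTemkinWlodarczyk2024,
§5.1 (p. 1575)] -/
theorem not_stepIncreases_of_stepDrops (h : StepDrops a W') : ¬ StepIncreases a W' := by
  rintro ⟨b, hb, hab⟩
  exact ATW.TruncLex.lt_irrefl a (ATW.TruncLex.lt_trans hab (h b hb))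

/-- DROP and STALL exclude each other. [cite: AbramovichTemkinWlodarczyk2024, §5.1 (p. 1575)] -/
theorem not_stepStalls_of_stepDrops (h : StepDrops a W') : ¬ StepStalls a W' :=
  fun hs => ATW.TruncLex.lt_irrefl a (h a hs.1)

/-- STALL and INCREASE exclude each other. [cite: AbramovichTemkinWlodarczyk2024, §5.1 (p. 1575)] -/
theorem not_stepIncreases_of_stepStalls (h : StepStalls a W') : ¬ StepIncreases a W' := by
  rintro ⟨b, hb, hab⟩
  exact h.2 b hb hab

/-- **Trichotomy of the verdict** when the new germ has a certified maximum: exactly one of DROP,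
STALL, INCREASE. [cite: AbramovichTemkinWlodarczyk2024, §5.1 (p. 1575)] -/
theorem stepDrops_or_stepStalls_or_stepIncreases (ha' : IsMaxInv W' a') :
    StepDrops a W' ∨ StepStalls a W' ∨ StepIncreases a W' := by
  rcases ATW.TruncLex.trichotomous a' a with h | h | h
  · exact Or.inl ((stepDrops_iff ha').mpr h)
  · exact Or.inr (Or.inl ((stepStalls_iff ha').mpr h))
  · exact Or.inr (Or.inr ((stepIncreases_iff ha').mpr h))

variable {k : Type*} [Field k]

/-- The entries of `exps γ` are the inverses `1/γᵢ` (`γᵢ ≠ 0`) (copy of the private lemma of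
`WeightedCentreInvariantSet`). [folklore] -/
private theorem exists_eq_inv_of_mem_exps' {m : ℕ} {γ : Fin m → ℚ} {x : ℚ} (hx : x ∈ exps γ) :
    ∃ i, γ i ≠ 0 ∧ x = (γ i)⁻¹ := by
  unfold exps at hx
  rw [List.mem_insertionSort, List.mem_map] at hx
  obtain ⟨i, hi, rfl⟩ := hx
  exact ⟨i, (Finset.mem_filter.mp (Finset.mem_toList.mp hi)).2, rfl⟩

/-- **Position 1 of the maximum is the order**: a `TruncLex`-maximal element of `W(g)`
(`ord g = ν`) starts with `ν` — it has an entry `≤ ν`, is sorted, and a first entry `< ν` is beaten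
by `(ν, …, ν)`. [cite: AbramovichTemkinWlodarczyk2024, Thm. 5.3.1 (2)–(3) and its proof (p. 1578)
(a₁ = ord)] -/
theorem exists_eq_cons_of_isMaxInv {m : ℕ} {g : MvPolynomial (Fin m) k} {ν : ℕ}
    (hν : monomialOrd (fun _ => 1) g = ν) {a : List ℚ} (ha : IsMaxInv (admissibleInvariants g) a) :
    ∃ as : List ℚ, a = (ν : ℚ) :: as := by
  obtain ⟨⟨Ψ, γ, h, rfl⟩, hmax⟩ := ha
  obtain ⟨x, hx, hxν⟩ := exists_mem_exps_le hν h
  obtain ⟨e, es, hees⟩ : ∃ e es, exps γ = e :: es := by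
    cases hl : exps γ with
    | nil => rw [hl] at hx; simp at hx
    | cons e es => exact ⟨e, es, rfl⟩
  have hs := exps_sorted γ
  rw [hees] at hs hx hmax ⊢
  have hex : e ≤ ν := by
    rcases List.mem_cons.mp hx with rfl | hx
    · exact hxν
    · exact ((List.pairwise_cons.mp hs).1 x hx).trans hxν
  rcases hex.lt_or_eq with hlt | heq
  · exfalso
    obtain ⟨i, hi, hei⟩ := exists_eq_inv_of_mem_exps' (show e ∈ exps γ by rw [hees]; simp)
    have he0 : 0 < e := by
      rw [hei]
      exact inv_pos.mpr (lt_of_le_of_ne (h.2.1 i) (Ne.symm hi))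
    have hν0 : 0 < ν := by exact_mod_cast he0.trans hlt
    apply hmax _ (replicate_mem_admissibleInvariants hν hν0).1
    cases m with
    | zero => simp
    | succ m' =>
      rw [List.replicate_succ, ATW.TruncLex.cons_lt_cons]
      exact Or.inl hlt
  · exact ⟨es, by rw [heq]⟩

/-- **Order drops ⟹ DROP.** If the new germ has order `< ν` then every invariant in `W(g)` is below
every list starting with `ν` (in particular below the old maximum of a germ of order `ν`).
[cite: AbramovichTemkinWlodarczyk2024, Thm. 5.3.1 (2) (p. 1578), §5.1 (p. 1575)] -/
theorem stepDrops_of_monomialOrd_lt {m : ℕ} {g : MvPolynomial (Fin m) k} {ν : ℕ}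
    (hlt : monomialOrd (fun _ => 1) g < ν) (as : List ℚ) :
    StepDrops ((ν : ℚ) :: as) (admissibleInvariants g) := by
  have hν0 : ν ≠ 0 := by
    rintro rfl
    rw [Nat.cast_zero] at hlt
    exact (not_le.mpr hlt) zero_le
  obtain ⟨ν₁, rfl⟩ : ∃ ν₁, ν = ν₁ + 1 := ⟨ν - 1, by omega⟩
  have hle : monomialOrd (fun _ => 1) g ≤ ν₁ := by
    rw [Nat.cast_succ] at hlt
    exact (ENat.lt_add_one_iff (ENat.coe_ne_top ν₁)).mp hlt
  rintro b' ⟨Ψ', γ', h', rfl⟩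
  obtain ⟨x, hx, hxν⟩ := exists_mem_le_of_monomialOrd_le hle (exps_mem_admissibleInvariants h')
  obtain ⟨e, es, hees⟩ : ∃ e es, exps γ' = e :: es := by
    cases hl : exps γ' with
    | nil => rw [hl] at hx; simp at hx
    | cons e es => exact ⟨e, es, rfl⟩
  have hs := exps_sorted γ'
  rw [hees] at hs hx ⊢
  have hex : e ≤ ν₁ := by
    rcases List.mem_cons.mp hx with rfl | hx
    · exact hxν
    · exact ((List.pairwise_cons.mp hs).1 x hx).trans hxν
  rw [ATW.TruncLex.cons_lt_cons]
  exact Or.inl (hex.trans_lt (by exact_mod_cast Nat.lt_succ_self ν₁))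

/-- **FE30 ORDER RULE against the certified old maximum**: if `a = max W(f)` (certified) and the
germ `G` one step later has order `< ord f`, then `G` is a DROP against `a` — whatever the rest of
`max W(G)` is. [cite: AbramovichTemkinWlodarczyk2024, §5.1 (p. 1575) (`a₁ = ord`, lexicographic
comparison)] -/
theorem stepDrops_of_isMaxInv_of_monomialOrd_lt {n m : ℕ} {f : MvPolynomial (Fin n) k} {ν : ℕ}
    (hν : monomialOrd (fun _ => 1) f = ν) {a : List ℚ} (ha : IsMaxInv (admissibleInvariants f) a)
    {g : MvPolynomial (Fin m) k} (hlt : monomialOrd (fun _ => 1) g < ν) :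
    StepDrops a (admissibleInvariants g) := by
  obtain ⟨as, rfl⟩ := exists_eq_cons_of_isMaxInv hν ha
  exact stepDrops_of_monomialOrd_lt hlt as

end Verdicts

/-! ## §5 The torus classes of the exceptional fibre: `W(G_{t·b}) = W(G_b)` -/

section DiagScale

variable {τ : Type*} {K : Type*} [Field K]

/-- The diagonal coordinate scaling `X_j ↦ c_j·X_j` (all `c_j ≠ 0`) as a `K`-algebra automorphism of
the polynomial ring.  The torus element `t ∈ 𝔾_m` of the cobordant blow-up `B ∋ (s, z')` acts by such
a scaling (`s ↦ t·s`, `z'_i ↦ t^{-w_i}·z'_i` is the substitution realising `t·(s, z') = (t⁻¹s, t^{w}z')`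
on functions). [cite: AbramovichQuekSchober2025, Construction 4.2 (the 𝔾_m-action
`t·(s, x') = (t⁻¹s, t^{w₁}x'₁, t^{w₂}x'₂)` on `B`)] -/
def diagScale (c : τ → K) (hc : ∀ j, c j ≠ 0) : MvPolynomial τ K ≃ₐ[K] MvPolynomial τ K :=
  AlgEquiv.ofAlgHom (aeval fun j => C (c j) * X j) (aeval fun j => C (c j)⁻¹ * X j)
    (MvPolynomial.algHom_ext fun j => by
      simp only [AlgHom.coe_comp, Function.comp_apply, aeval_X, map_mul, aeval_C,
        MvPolynomial.algebraMap_eq, AlgHom.coe_id, id_eq]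
      rw [← mul_assoc, ← C_mul]
      simp [hc j])
    (MvPolynomial.algHom_ext fun j => by
      simp only [AlgHom.coe_comp, Function.comp_apply, aeval_X, map_mul, aeval_C,
        MvPolynomial.algebraMap_eq, AlgHom.coe_id, id_eq]
      rw [← mul_assoc, ← C_mul]
      simp [hc j])

/-- `D_c` is the substitution `X_j ↦ c_j·X_j`. [cite: AbramovichQuekSchober2025, Construction 4.2
(the action on the coordinates of `B`)] -/
theorem diagScale_apply (c : τ → K) (hc : ∀ j, c j ≠ 0) (G : MvPolynomial τ K) :
    diagScale c hc G = aeval (fun j => C (c j) * X j) G := rfl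

/-- `D_c X_j = c_j·X_j`. [cite: AbramovichQuekSchober2025, Construction 4.2 (the action on the
coordinates of `B`)] -/
@[simp] theorem diagScale_X (c : τ → K) (hc : ∀ j, c j ≠ 0) (j : τ) :
    diagScale c hc (X j) = C (c j) * X j := by
  rw [diagScale_apply, aeval_X]

/-- `D_c` fixes the constants. [cite: AbramovichQuekSchober2025, Construction 4.2 (a `k`-action)] -/
@[simp] theorem diagScale_C (c : τ → K) (hc : ∀ j, c j ≠ 0) (a : K) :
    diagScale c hc (C a) = C a := by
  rw [diagScale_apply, aeval_C, MvPolynomial.algebraMap_eq]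

/-- `D_c(a·X^E) = (a·∏_j c_j^{E_j})·X^E`: monomials are eigenvectors of the torus.
[cite: AbramovichQuekSchober2025, Construction 4.2 (weights of the `𝔾_m`-action)] -/
theorem diagScale_monomial (c : τ → K) (hc : ∀ j, c j ≠ 0) (E : τ →₀ ℕ) (a : K) :
    diagScale c hc (monomial E a) = monomial E (a * E.prod fun j m => c j ^ m) := by
  rw [diagScale_apply, MvPolynomial.aeval_monomial, MvPolynomial.algebraMap_eq]
  simp_rw [mul_pow, ← C_pow]
  have h1 : (E.prod fun j m => C (c j ^ m) : MvPolynomial τ K) = C (E.prod fun j m => c j ^ m) :=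
    (map_finsuppProd (C : K →+* MvPolynomial τ K) E (fun j m => c j ^ m)).symm
  rw [Finsupp.prod_mul, h1, ← mul_assoc, ← C_mul, ← MvPolynomial.monomial_eq]

/-- Translation fixes constants (plumbing). [folklore] -/
private theorem translate_C' (b : τ → K) (a : K) : PointBlowup.translate b (C a : MvPolynomial τ K) = C a := by
  unfold PointBlowup.translate
  rw [aeval_C, MvPolynomial.algebraMap_eq]

/-- Translation on a variable (plumbing). [folklore] -/
private theorem translate_X' (b : τ → K) (j : τ) :
    PointBlowup.translate b (X j : MvPolynomial τ K) = X j + C (b j) := by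
  unfold PointBlowup.translate
  rw [aeval_X]

/-- Translation is additive (plumbing). [folklore] -/
private theorem translate_add' (b : τ → K) (G H : MvPolynomial τ K) :
    PointBlowup.translate b (G + H) = PointBlowup.translate b G + PointBlowup.translate b H := by
  unfold PointBlowup.translate
  exact map_add _ _ _

/-- Translation is multiplicative (plumbing). [folklore] -/
private theorem translate_mul' (b : τ → K) (G H : MvPolynomial τ K) :
    PointBlowup.translate b (G * H) = PointBlowup.translate b G * PointBlowup.translate b H := by
  unfold PointBlowup.translate
  exact map_mul _ _ _

/-- **Diagonal scalings conjugate translations**: if `c_j·b'_j = b_j` for all `j` then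
`translate_{b'} ∘ D_c = D_c ∘ translate_b` (the torus moves the point `b` to `b'` and carries the
germ at `b` to the germ at `b'`). [cite: AbramovichQuekSchober2025, Construction 4.2 (the
`𝔾_m`-action moves the points of `B`)] -/
theorem translate_diagScale (c : τ → K) (hc : ∀ j, c j ≠ 0) (b b' : τ → K)
    (hcb : ∀ j, c j * b' j = b j) (G : MvPolynomial τ K) :
    PointBlowup.translate b' (diagScale c hc G) = diagScale c hc (PointBlowup.translate b G) := by
  induction G using MvPolynomial.induction_on with
  | C a => rw [diagScale_C, translate_C', translate_C', diagScale_C]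
  | add p q hp hq => rw [map_add, translate_add', translate_add', map_add, hp, hq]
  | mul_X p j hp =>
    simp only [map_mul, map_add, translate_mul', translate_C', translate_X', diagScale_X,
      diagScale_C, hp]
    congr 1
    rw [mul_add, ← C_mul, hcb]

end DiagScale

section Torus

variable {σ : Type*} {K : Type*} [Field K]

/-- The scaling factors of the torus element `t` on the coordinate functions of the cobordant chart
`B ∋ (s, z')`: `s ↦ t·s`, `z'_i ↦ t^{-w_i}·z'_i`. [cite: AbramovichQuekSchober2025, Construction 4.2
(`t·(s, x') = (t⁻¹s, t^{w}x')`)] -/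
def torusScale (w : σ → ℕ) (t : K) : Option σ → K
  | none => t
  | some i => (t ^ w i)⁻¹

/-- Unfolding `torusScale` at `s` (plumbing). [folklore] -/
@[simp] private theorem torusScale_none (w : σ → ℕ) (t : K) : torusScale w t none = t := rfl

/-- Unfolding `torusScale` at `z'ᵢ` (plumbing). [folklore] -/
@[simp] private theorem torusScale_some (w : σ → ℕ) (t : K) (i : σ) :
    torusScale w t (some i) = (t ^ w i)⁻¹ := rfl

/-- The scaling factors of `t ∈ 𝔾_m` (`t ≠ 0`) are non-zero. [cite: AbramovichQuekSchober2025,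
Construction 4.2 (`𝔾_m = Spec k[t, t⁻¹]`)] -/
theorem torusScale_ne_zero (w : σ → ℕ) {t : K} (ht : t ≠ 0) : ∀ j, torusScale w t j ≠ 0
  | none => ht
  | some _ => inv_ne_zero (pow_ne_zero _ ht)

/-- The torus moves the point `(s, z') = (0, b)` of the exceptional divisor `{s = 0}` to
`t·(0, b) = (0, t^{w_i}·b_i)`; these are the `k`-orbit classes of FE30 §1(3).
[cite: AbramovichQuekSchober2025, Construction 4.2 and Def. 4.3 (`Bl = [B₊/𝔾_m]`)] -/
def torusPoint (w : σ → ℕ) (t : K) (b : Option σ → K) : Option σ → K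
  | none => 0
  | some i => t ^ w i * b (some i)

/-- Unfolding `torusPoint` at `s` (plumbing). [folklore] -/
@[simp] private theorem torusPoint_none (w : σ → ℕ) (t : K) (b : Option σ → K) :
    torusPoint w t b none = 0 := rfl

/-- Unfolding `torusPoint` at `z'ᵢ` (plumbing). [folklore] -/
@[simp] private theorem torusPoint_some (w : σ → ℕ) (t : K) (b : Option σ → K) (i : σ) :
    torusPoint w t b (some i) = t ^ w i * b (some i) := rfl

/-- `c_j·(t·b)_j = b_j` for the torus scaling and the moved point (plumbing). [folklore] -/
private theorem torusScale_mul_torusPoint (w : σ → ℕ) {t : K} (ht : t ≠ 0) (b : Option σ → K)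
    (hb0 : b none = 0) : ∀ j, torusScale w t j * torusPoint w t b j = b j
  | none => by rw [torusScale_none, torusPoint_none, hb0, mul_zero]
  | some i => by rw [torusScale_some, torusPoint_some, inv_mul_cancel_left₀ (pow_ne_zero _ ht)]

variable [Fintype σ]

/-- The weight of an exponent as a plain sum. [folklore] -/
private theorem weight_eq_sum (w : σ → ℕ) (d : σ →₀ ℕ) : Finsupp.weight w d = ∑ i, w i * d i := by
  rw [Finsupp.weight_apply, Finsupp.sum_fintype _ _ (fun i => by simp)]
  simp only [smul_eq_mul, mul_comm]

/-- The torus scales the monomial `X^{E(d)}` of the cobordant transform (`E(d) = (Σ wᵢdᵢ − ℓ, d)`) by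
`t^{(Σ wᵢdᵢ − ℓ) − Σ wᵢdᵢ} = t^{−ℓ}`. [folklore] -/
private theorem prod_torusScale_cobordantExponent (w : σ → ℕ) (ℓ : ℕ) {t : K} (ht : t ≠ 0) (d : σ →₀ ℕ)
    (hd : ℓ ≤ Finsupp.weight w d) :
    ((cobordantExponent w ℓ d).prod fun j m => torusScale w t j ^ m) = (t ^ ℓ)⁻¹ := by
  rw [weight_eq_sum] at hd
  rw [Finsupp.prod_fintype _ _ (fun j => pow_zero _), Fintype.prod_option, cobordantExponent_none]
  simp_rw [cobordantExponent_some, torusScale_none, torusScale_some, inv_pow, ← pow_mul]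
  rw [Finset.prod_inv_distrib, Finset.prod_pow_eq_pow_sum, pow_sub₀ _ ht hd, mul_assoc,
    mul_comm ((t ^ ℓ)⁻¹), ← mul_assoc, mul_inv_cancel₀ (pow_ne_zero _ ht), one_mul]

/-- **Semi-invariance of the cobordant transform under the torus**: `F'(t⁻¹s, t^{w}z') = t^{ℓ}F'(s, z')`,
i.e. `D_t F' = t^{−ℓ}·F'` for the coordinate scaling `D_t` — valid as soon as every monomial of `F`
has `w`-weight `≥ ℓ` (`J ≤ v(F)`, integer weights). [cite: AbramovichQuekSchober2025, Def. 4.5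
(`f' = s^{−ℓ}f(s^{w}x')`) and Construction 4.2] -/
theorem diagScale_cobordantTransform (w : σ → ℕ) (ℓ : ℕ) {t : K} (ht : t ≠ 0) (F : MvPolynomial σ K)
    (hF : ∀ d ∈ F.support, ℓ ≤ Finsupp.weight w d) :
    diagScale (torusScale w t) (torusScale_ne_zero w ht) (cobordantTransform w ℓ F) =
      C (t ^ ℓ)⁻¹ * cobordantTransform w ℓ F := by
  unfold cobordantTransform
  rw [map_sum, Finset.mul_sum]
  refine Finset.sum_congr rfl fun d hd => ?_
  rw [diagScale_monomial, prod_torusScale_cobordantExponent w ℓ ht d (hF d hd), C_mul_monomial,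
    mul_comm]

/-- **The torus class of a point of the exceptional fibre.**  For a point `(0, b)` of `{s = 0}` and
`t ≠ 0`, the germ of the proper transform at `t·b` is the germ at `b` up to a unit and a diagonal
coordinate change: `G_{t·b} = t^{ℓ}·D_t(G_b)`.  Hence every coordinate-free local invariant agrees on
the two points — one representative per class suffices (FE30 §1(3)).
[cite: AbramovichQuekSchober2025, Construction 4.2, Def. 4.3 and Def. 4.5] -/
theorem pointPolynomial_torusPoint (w : σ → ℕ) (ℓ : ℕ) {t : K} (ht : t ≠ 0) (b : Option σ → K)
    (hb0 : b none = 0) (F : MvPolynomial σ K) (hF : ∀ d ∈ F.support, ℓ ≤ Finsupp.weight w d) :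
    pointPolynomial w ℓ (torusPoint w t b) F =
      C (t ^ ℓ) * diagScale (torusScale w t) (torusScale_ne_zero w ht) (pointPolynomial w ℓ b F) := by
  unfold pointPolynomial
  rw [← translate_diagScale _ _ b _ (torusScale_mul_torusPoint w ht b hb0),
    diagScale_cobordantTransform w ℓ ht F hF, translate_mul', translate_C', ← mul_assoc, ← C_mul,
    mul_inv_cancel₀ (pow_ne_zero _ ht), C_1, one_mul]

end Torus

section TorusKernel

variable {k : Type*} [Field k] {n : ℕ}

/-- Integer admissibility from rational admissibility: if `wᵢ = ℓγᵢ` and `γ` is admissible for `g`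
then every monomial of `g` has `w`-weight `≥ ℓ`. [cite: AbramovichTemkinWlodarczyk2024, Def. 2.4.1 (3)
(p. 1568) (reduced centre, integer weights)] -/
theorem forall_le_weight_of_isAdmissibleFor {σ : Type*} [Fintype σ] {γ : σ → ℚ} {w : σ → ℕ} {ℓ : ℕ}
    (hℓ : 0 < ℓ) (hw : ∀ i, (w i : ℚ) = ℓ * γ i) {g : MvPolynomial σ k} (hg : IsAdmissibleFor γ g) :
    ∀ d ∈ g.support, ℓ ≤ Finsupp.weight w d :=
  (le_monomialOrd_iff w g ℓ).mp ((isAdmissibleFor_iff_le_monomialOrd γ w hℓ hw g).mp hg)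

/-- **FE30 §1(3) in the kernel model: points of `E_0` in one torus class have the same invariant
set.**  `W(G_{t·b}) = W(G_b)` for `t ≠ 0`, `b` on the exceptional divisor, and `g` with
`w`-weights `≥ ℓ` (e.g. `g = Ψ⁻¹f` for a centre of `f` with `wᵢ = ℓγᵢ`,
`forall_le_weight_of_isAdmissibleFor`).  [cite: AbramovichQuekSchober2025, Construction 4.2 and
Def. 4.3 (`Bl_J̄ = [B₊/𝔾_m]`: the invariant is a function on the quotient)] -/
theorem admissibleInvariants_stepGerm_torusPoint (w : Fin n → ℕ) (ℓ : ℕ) {t : k} (ht : t ≠ 0)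
    (b : Option (Fin n) → k) (hb0 : b none = 0) (g : MvPolynomial (Fin n) k)
    (hg : ∀ d ∈ g.support, ℓ ≤ Finsupp.weight w d) :
    admissibleInvariants (stepGerm w ℓ (torusPoint w t b) g) =
      admissibleInvariants (stepGerm w ℓ b g) := by
  let D : MvPolynomial (Option (Fin n)) k ≃ₐ[k] MvPolynomial (Option (Fin n)) k :=
    diagScale (torusScale w t) (torusScale_ne_zero w ht)
  let Φ : MvPolynomial (Fin (n + 1)) k ≃ₐ[k] MvPolynomial (Fin (n + 1)) k :=
    ((renameEquiv k (finSuccEquiv n).symm).symm.trans D).trans (renameEquiv k (finSuccEquiv n).symm)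
  have hΦ : ∀ G, Φ (rename (finSuccEquiv n).symm G) = rename (finSuccEquiv n).symm (D G) := by
    intro G
    simp only [Φ, AlgEquiv.trans_apply, renameEquiv_symm, renameEquiv_apply, rename_rename,
      Equiv.symm_comp_self, rename_id, AlgHom.coe_id, id_eq]
  have hΦ0 : ∀ i, constantCoeff (Φ (X i)) = 0 := by
    intro i
    simp only [Φ, D, AlgEquiv.trans_apply, renameEquiv_symm, renameEquiv_apply, rename_X, diagScale_X,
      map_mul, rename_C, constantCoeff_C, constantCoeff_X, mul_zero]
  have key : stepGerm w ℓ (torusPoint w t b) g = C (t ^ ℓ) * Φ (stepGerm w ℓ b g) := by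
    unfold stepGerm
    rw [hΦ, pointPolynomial_torusPoint w ℓ ht b hb0 g hg, map_mul, rename_C]
  rw [key, admissibleInvariants_C_mul (pow_ne_zero _ ht), admissibleInvariants_map_eq Φ hΦ0]

/-- The same for a centre of `f` read in its own coordinates (`g = Ψ⁻¹f`, `wᵢ = ℓγᵢ`).
[cite: AbramovichQuekSchober2025, Construction 4.2 and Def. 4.3 (`Bl_J̄ = [B₊/𝔾_m]`)] -/
theorem admissibleInvariants_stepGerm_torusPoint_of_isCentreFor {f : MvPolynomial (Fin n) k}
    {Ψ : MvPolynomial (Fin n) k ≃ₐ[k] MvPolynomial (Fin n) k} {γ : Fin n → ℚ} (h : IsCentreFor f Ψ γ)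
    {w : Fin n → ℕ} {ℓ : ℕ} (hw : ∀ i, (w i : ℚ) = ℓ * γ i) (hℓ : 0 < ℓ) {t : k} (ht : t ≠ 0)
    (b : Option (Fin n) → k) (hb0 : b none = 0) :
    admissibleInvariants (stepGerm w ℓ (torusPoint w t b) (Ψ.symm f)) =
      admissibleInvariants (stepGerm w ℓ b (Ψ.symm f)) :=
  admissibleInvariants_stepGerm_torusPoint w ℓ ht b hb0 (Ψ.symm f)
    (forall_le_weight_of_isAdmissibleFor hℓ hw h.2.2)

end TorusKernel

end WeightedBlowup

end Literature.AlgebraicGeometry.Resolution
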